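import Literature.Geometry.Lorentzian.SpacetimeChartDeviationTransfer
import Literature.Geometry.Lorentzian.StationaryFinalStateDecomposition
import Literature.Geometry.Manifold.OpenSubmanifoldMFDeriv
import HarnessLib

/-!
# Route ZeroEnergyKerrOrBomb · crux `StationaryLimitReduction` (stmt-FinalStateConjecture-10021), line
# `symplectic-dual-of-the-bomb` — re-adapting a late chart along a map of model domains: the metric
# deviation of `ψ ∘ Φ` is the coordinate pullback of the deviation of `ψ` (identification step of
# `stub_chartTransfer`)

Helper file (`--supports stmt-FinalStateConjecture-10021`; registered helper
`deviation_readapt_eq`) from the lead's wave-1 stub-worker for `stub_chartTransfer` (lead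
prover-line-stmt-FinalStateConjecture-10021-a1-0, 2026-08-16). For two reference backgrounds `B₁, B₂`
(`KerrConvergence.lean`), a chart `ψ : B₁.domain → 𝓢` and a smooth map `Φ : E4 → E4` with
`Φ(B₂.domain) ⊆ B₁.domain`, the re-adapted chart is `ψ ∘ Φ̂`, `Φ̂ : B₂.domain → B₁.domain` the
restriction. This file proves:

* §1 `contMDiff_readapt`, `mfderiv_readapt` — `Φ̂` is smooth between the open submanifolds and its
  manifold derivative is `fderiv ℝ Φ` (`OpenSubmanifold.mfderiv_subtype_val`);
* §2 `deviation_readapt` — the POINTWISE IDENTITY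
  `deviation B₂ (ψ ∘ Φ̂) x = bilinPullback Φ (deviationExtend B₁ ψ) x + (bilinPullback Φ B₁.bilin x − B₂.bilin x)`:
  the deviation of the re-adapted chart is the coordinate pullback (`BilinPullbackEstimates.lean`) of
  the old deviation plus the MODEL MISMATCH `Φ^* g₁ − g₂` (chain rule `pullbackBilin_comp`);
* §3 `contDiffOn_deviationExtend` — the old deviation, extended by zero, is `C^∞` on the old domain
  when `ψ` is smooth and `B₁.bilin` is (`contDiffOn_metricInCoords`), and `contDiffOn_adaptedChart_bilin`,
  `contDiffOn_boost_bilin` — the components of an adapted chart of a stationary hole, and of its moved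
  background, are `C^∞` on their domains;
* §4 `fderiv_conj` — the derivative of the conjugate `Φ = P ∘ Θ ∘ P⁻¹` by a motion, and
  `bilinPullback_conj_boost_eq_boostedKerrBilin` — under the ISOMETRY CLAUSE of `IsKerrCharted`
  (`A.bilin (Θ z)(DΘ v, DΘ w) = Kerr.bilin M a z v w` on the exterior) the model mismatch of §2 vanishes
  for `B₁ = A.background.boost Λ c₀`, `B₂ = boostedKerrBackground Λ c₀ M a`; whence the registered
  `deviation_readapt_eq`: on the boosted Kerr exterior the deviation of `ψ ∘ Φ̂` from boosted Kerr IS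
  `bilinPullback Φ (deviationExtend (A.background.boost Λ c₀) ψ)`, and (`truncDeviationCk_readapt_eq`)
  its truncated slab norms are those of that pullback (germ invariance `supCkENorm_congr`).

Together with `boostedKerr_truncSlab_pullback_tendsto_zero` (`…KerrSchildSlabs.lean`) this closes the
near-zone convergence clause of the transfer. Elementary; no named fact, nothing restated. References:
O'Neill 1983, Ch. 3, Def. 3.9 and p. 58 (pullbacks, chain rule); Petersen 2006, Ch. 10, §3.2.
-/

-- every `Summit.FinalStateConjecture.FinalStateConjecture.…` name repeats the summit = sub-problem segment (D-0017 layout)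
set_option linter.dupNamespace false

noncomputable section

open scoped Topology ENNReal Manifold ContDiff
open Set Filter Function

namespace Summit.FinalStateConjecture.FinalStateConjecture.Theorems.SymplecticDualOfTheBomb

open Literature.Geometry.Lorentzian Literature.Geometry.Manifold

/-! ## §1 Restricting a smooth map of `E4` to open submanifolds -/

section Readapt

variable {U V : TopologicalSpace.Opens E4} {Φ : E4 → E4} (hmaps : MapsTo Φ (U : Set E4) (V : Set E4))

/-- The restriction `Φ̂ : U → V` of a map `C^∞` on the open set `U` is smooth between the open
submanifolds. [folklore] -/
theorem contMDiff_readapt (hΦ : ContDiffOn ℝ ∞ Φ (U : Set E4)) :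
    ContMDiff 𝓘(ℝ, E4) 𝓘(ℝ, E4) ∞ (fun y : U ↦ (⟨Φ y.1, hmaps y.2⟩ : V)) := by
  rw [← ContMDiff.subtypeVal_comp_iff]
  intro y
  have h : ContMDiffAt 𝓘(ℝ, E4) 𝓘(ℝ, E4) ∞ Φ y.1 :=
    contMDiffAt_iff_contDiffAt.2 (hΦ.contDiffAt (U.isOpen.mem_nhds y.2))
  exact contMDiffAt_subtype_iff.2 h

/-- **The manifold derivative of the restriction is the derivative**: `dΦ̂_y = DΦ(y)` under
`T_y U = E4 = T_{Φ y} V`. [folklore] -/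
theorem mfderiv_readapt (hΦ : ContDiffOn ℝ ∞ Φ (U : Set E4)) (y : U) :
    mfderiv 𝓘(ℝ, E4) 𝓘(ℝ, E4) (fun y : U ↦ (⟨Φ y.1, hmaps y.2⟩ : V)) y = fderiv ℝ Φ y.1 := by
  have hd : MDifferentiableAt 𝓘(ℝ, E4) 𝓘(ℝ, E4) (fun y : U ↦ (⟨Φ y.1, hmaps y.2⟩ : V)) y :=
    (contMDiff_readapt hmaps hΦ y).mdifferentiableAt (by simp)
  have h1 := mfderiv_comp y (OpenSubmanifold.mdifferentiableAt_subtype_val _) hd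
  have hΦd : MDifferentiableAt 𝓘(ℝ, E4) 𝓘(ℝ, E4) Φ y.1 :=
    ((hΦ.differentiableOn (by simp)).differentiableAt (U.isOpen.mem_nhds y.2)).mdifferentiableAt
  have h2 := mfderiv_comp y hΦd (OpenSubmanifold.mdifferentiableAt_subtype_val y)
  have h3 : (Subtype.val ∘ fun y : U ↦ (⟨Φ y.1, hmaps y.2⟩ : V)) = Φ ∘ Subtype.val := rfl
  rw [h3, h2] at h1
  -- `h1 : (DΦ).comp (d val) = (d val).comp (dΦ̂)`; evaluate
  ext v
  have h4 := congrArg (fun L : E4 →L[ℝ] E4 ↦ L v) h1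
  simp only [OpenSubmanifold.mfderiv_subtype_val, mfderiv_eq_fderiv] at h4
  exact h4.symm

end Readapt

/-! ## §2 The deviation of a re-adapted chart -/

section Deviation

variable (𝓢 : Spacetime.{0} 4) (B₁ B₂ : ModelBackground)

/-- Values of the extended deviation on the domain (`deviationExtend_coe`, point form). [folklore] -/
theorem deviationExtend_apply_of_mem (ψ : B₁.domain → 𝓢.carrier) {u : E4} (hu : u ∈ (B₁.domain : Set E4)) :
    𝓢.deviationExtend B₁ ψ u = 𝓢.deviation B₁ ψ ⟨u, hu⟩ :=
  𝓢.deviationExtend_coe B₁ ψ ⟨u, hu⟩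

/-- **The deviation of the re-adapted chart.** For `ψ : B₁.domain → 𝓢` differentiable, `Φ` smooth
on `B₂.domain` with `Φ(B₂.domain) ⊆ B₁.domain`, and `x ∈ B₂.domain`:
`deviation B₂ (ψ ∘ Φ̂) x = bilinPullback Φ (deviationExtend B₁ ψ) x + (bilinPullback Φ B₁.bilin x − B₂.bilin x)`
— old deviation pulled back, plus the model mismatch `Φ^* g₁ − g₂` (chain rule for pullbacks,
O'Neill 1983, Ch. 3, p. 58). [folklore] -/
theorem deviation_readapt {ψ : B₁.domain → 𝓢.carrier} (hψ : MDifferentiable 𝓘(ℝ, E4) (𝓡 4) ψ)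
    {Φ : E4 → E4} (hΦ : ContDiffOn ℝ ∞ Φ (B₂.domain : Set E4))
    (hmaps : MapsTo Φ (B₂.domain : Set E4) (B₁.domain : Set E4)) (x : B₂.domain) :
    𝓢.deviation B₂ (fun y ↦ ψ ⟨Φ y.1, hmaps y.2⟩) x =
      bilinPullback Φ (𝓢.deviationExtend B₁ ψ) x.1 +
        (bilinPullback Φ B₁.bilin x.1 - B₂.bilin x.1) := by
  have hΦ' : MDifferentiable 𝓘(ℝ, E4) 𝓘(ℝ, E4)
      (fun y : B₂.domain ↦ (⟨Φ y.1, hmaps y.2⟩ : B₁.domain)) :=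
    (contMDiff_readapt hmaps hΦ).mdifferentiable (by simp)
  have hcomp : (fun y : B₂.domain ↦ ψ ⟨Φ y.1, hmaps y.2⟩) =
      ψ ∘ fun y : B₂.domain ↦ (⟨Φ y.1, hmaps y.2⟩ : B₁.domain) := rfl
  have hd := mfderiv_comp x (hψ _) (hΦ' x)
  rw [mfderiv_readapt hmaps hΦ x] at hd
  ext v w
  -- the three terms, evaluated on `(v, w)`
  have e1 : 𝓢.deviation B₂ (fun y ↦ ψ ⟨Φ y.1, hmaps y.2⟩) x v w =
      𝓢.metric.val (ψ ⟨Φ x.1, hmaps x.2⟩)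
          (mfderiv 𝓘(ℝ, E4) (𝓡 4) ψ ⟨Φ x.1, hmaps x.2⟩ (fderiv ℝ Φ x.1 v))
          (mfderiv 𝓘(ℝ, E4) (𝓡 4) ψ ⟨Φ x.1, hmaps x.2⟩ (fderiv ℝ Φ x.1 w)) -
        B₂.bilin x.1 v w := by
    rw [Spacetime.deviation_apply, hcomp, hd]
    rfl
  have e2 : bilinPullback Φ (𝓢.deviationExtend B₁ ψ) x.1 v w =
      𝓢.metric.val (ψ ⟨Φ x.1, hmaps x.2⟩)
          (mfderiv 𝓘(ℝ, E4) (𝓡 4) ψ ⟨Φ x.1, hmaps x.2⟩ (fderiv ℝ Φ x.1 v))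
          (mfderiv 𝓘(ℝ, E4) (𝓡 4) ψ ⟨Φ x.1, hmaps x.2⟩ (fderiv ℝ Φ x.1 w)) -
        B₁.bilin (Φ x.1) (fderiv ℝ Φ x.1 v) (fderiv ℝ Φ x.1 w) := by
    rw [bilinPullback_apply, deviationExtend_apply_of_mem 𝓢 B₁ ψ (hmaps x.2), Spacetime.deviation_apply]
  have e3 : (bilinPullback Φ B₁.bilin x.1 - B₂.bilin x.1) v w =
      B₁.bilin (Φ x.1) (fderiv ℝ Φ x.1 v) (fderiv ℝ Φ x.1 w) - B₂.bilin x.1 v w := by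
    rw [← bilinPullback_apply Φ B₁.bilin x.1 v w]
    rfl
  have e4 : (bilinPullback Φ (𝓢.deviationExtend B₁ ψ) x.1 +
      (bilinPullback Φ B₁.bilin x.1 - B₂.bilin x.1)) v w =
        bilinPullback Φ (𝓢.deviationExtend B₁ ψ) x.1 v w +
          (bilinPullback Φ B₁.bilin x.1 - B₂.bilin x.1) v w := rfl
  rw [e1, e4, e2, e3]
  ring

end Deviation

/-! ## §3 Smoothness of the deviation and of adapted-chart components -/

section Smoothness

variable (𝓢 : Spacetime.{0} 4) (B : ModelBackground)

/-- Extending a chart on an open set of `E4` to all of `E4` (junk value `ψ x₀` off the domain) gives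
a map `C^∞` on the domain as a map of `E4`. [folklore] -/
theorem contMDiffOn_extend_val {ψ : B.domain → 𝓢.carrier} (hψ : ContMDiff 𝓘(ℝ, E4) (𝓡 4) ∞ ψ)
    (x₀ : B.domain) :
    ContMDiffOn 𝓘(ℝ, E4) (𝓡 4) ∞ (Function.extend Subtype.val ψ fun _ ↦ ψ x₀) (B.domain : Set E4) := by
  intro u hu
  have h : ContMDiffAt 𝓘(ℝ, E4) (𝓡 4) ∞
      (fun y : B.domain ↦ Function.extend Subtype.val ψ (fun _ ↦ ψ x₀) y.1) ⟨u, hu⟩ := by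
    have heq : (fun y : B.domain ↦ Function.extend Subtype.val ψ (fun _ ↦ ψ x₀) y.1) = ψ :=
      funext fun y ↦ Subtype.val_injective.extend_apply _ _ y
    rw [heq]
    exact hψ _
  exact (contMDiffAt_subtype_iff.1 h).contMDiffWithinAt

/-- On the domain the extended deviation is `metricInCoords` of the extended chart minus the reference
form. [folklore] -/
theorem deviationExtend_eq_metricInCoords_sub {ψ : B.domain → 𝓢.carrier}
    (hψ : ContMDiff 𝓘(ℝ, E4) (𝓡 4) ∞ ψ) (x₀ : B.domain) {u : E4} (hu : u ∈ (B.domain : Set E4)) :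
    𝓢.deviationExtend B ψ u =
      𝓢.metricInCoords (Function.extend Subtype.val ψ fun _ ↦ ψ x₀) u - B.bilin u := by
  have hψ' : (Function.extend Subtype.val ψ fun _ ↦ ψ x₀) ∘ (Subtype.val : B.domain → E4) = ψ :=
    funext fun y ↦ Subtype.val_injective.extend_apply _ _ y
  have hz : MDifferentiableAt 𝓘(ℝ, E4) (𝓡 4) (Function.extend Subtype.val ψ fun _ ↦ ψ x₀) u :=
    ((contMDiffOn_extend_val 𝓢 B hψ x₀ u hu).contMDiffAt (B.domain.isOpen.mem_nhds hu)).mdifferentiableAt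
      (by simp)
  rw [deviationExtend_apply_of_mem 𝓢 B ψ hu, Spacetime.deviation,
    ← 𝓢.pullbackBilin_comp_subtypeVal_eq_metricInCoords ⟨u, hu⟩ hz, hψ']

/-- **The old deviation is smooth on the old domain**: if `ψ` is `C^∞` and the reference components
`B.bilin` are `C^∞` on `B.domain`, so is `deviationExtend B ψ` (`contDiffOn_metricInCoords`).
[folklore] -/
theorem contDiffOn_deviationExtend {ψ : B.domain → 𝓢.carrier} (hψ : ContMDiff 𝓘(ℝ, E4) (𝓡 4) ∞ ψ)
    (hB : ContDiffOn ℝ ∞ B.bilin (B.domain : Set E4)) :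
    ContDiffOn ℝ ∞ (𝓢.deviationExtend B ψ) (B.domain : Set E4) := by
  intro u hu
  have x₀ : B.domain := ⟨u, hu⟩
  have h := ((𝓢.contDiffOn_metricInCoords B.domain.isOpen (contMDiffOn_extend_val 𝓢 B hψ x₀)).sub hB)
  refine (h.congr fun y hy ↦ ?_) u hu
  exact deviationExtend_eq_metricInCoords_sub 𝓢 B hψ x₀ hy

variable {𝓑 : StationaryAFBlackHole.{0}} (A : 𝓑.AdaptedChart)

/-- **The components of an adapted chart are smooth on its domain** (`A.bilin = φ^* g_𝓑` there,
`A.bilin_eq`, and `φ` is smooth). [folklore] -/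
theorem contDiffOn_adaptedChart_bilin : ContDiffOn ℝ ∞ A.bilin (A.domain : Set E4) := by
  by_cases hne : (A.domain : Set E4).Nonempty
  · obtain ⟨u₀, hu₀⟩ := hne
    have hφ' : (Function.extend Subtype.val A.toFun fun _ ↦ A.toFun ⟨u₀, hu₀⟩) ∘
        (Subtype.val : A.domain → E4) = A.toFun :=
      funext fun y ↦ Subtype.val_injective.extend_apply _ _ y
    have hsm : ContMDiffOn 𝓘(ℝ, E4) (𝓡 4) ∞
        (Function.extend Subtype.val A.toFun fun _ ↦ A.toFun ⟨u₀, hu₀⟩) (A.domain : Set E4) :=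
      contMDiffOn_extend_val 𝓑.toSpacetime A.background A.contMDiff ⟨u₀, hu₀⟩
    have h := 𝓑.toSpacetime.contDiffOn_metricInCoords A.domain.isOpen hsm
    refine h.congr fun u hu ↦ ?_
    have hz : MDifferentiableAt 𝓘(ℝ, E4) (𝓡 4)
        (Function.extend Subtype.val A.toFun fun _ ↦ A.toFun ⟨u₀, hu₀⟩) u :=
      ((hsm u hu).contMDiffAt (A.domain.isOpen.mem_nhds hu)).mdifferentiableAt (by simp)
    rw [A.bilin_eq ⟨u, hu⟩, ← 𝓑.toSpacetime.pullbackBilin_comp_subtypeVal_eq_metricInCoords ⟨u, hu⟩ hz,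
      hφ']
  · rw [not_nonempty_iff_eq_empty.1 hne]
    exact contDiffOn_empty

/-- The derivative of the inverse Poincaré map `x ↦ Λ⁻¹(x − c₀)` is `Λ⁻¹`. [folklore] -/
theorem hasFDerivAt_poincareInv (Λ : lorentzGroup) (c₀ x : E4) :
    HasFDerivAt (poincareInv Λ c₀) ((Λ : E4 ≃L[ℝ] E4).symm : E4 →L[ℝ] E4) x := by
  have h := ((Λ : E4 ≃L[ℝ] E4).symm : E4 →L[ℝ] E4).hasFDerivAt.comp x
    ((hasFDerivAt_id x).sub_const c₀)
  rwa [ContinuousLinearMap.comp_id] at h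

/-- The components of the moved background are the coordinate pullback of the rest-frame ones
along the inverse Poincaré map. [folklore] -/
theorem boost_bilin_eq_bilinPullback (B : ModelBackground) (Λ : lorentzGroup) (c₀ : E4) :
    (B.boost Λ c₀).bilin = bilinPullback (poincareInv Λ c₀) B.bilin := by
  funext x
  ext v w
  rw [ModelBackground.boost_bilin_apply, bilinPullback_apply, (hasFDerivAt_poincareInv Λ c₀ x).fderiv]
  rfl

/-- **The components of the moved adapted background are smooth on the moved domain.** [folklore] -/
theorem contDiffOn_boost_bilin (Λ : lorentzGroup) (c₀ : E4) :
    ContDiffOn ℝ ∞ (A.background.boost Λ c₀).bilin ((A.background.boost Λ c₀).domain : Set E4) := by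
  rw [boost_bilin_eq_bilinPullback]
  have hθ : ContDiffOn ℝ (((⊤ : ℕ∞) + 1 : ℕ∞) : WithTop ℕ∞) (poincareInv Λ c₀)
      ((A.background.boost Λ c₀).domain : Set E4) :=
    ((Λ : E4 ≃L[ℝ] E4).symm.contDiff.comp (contDiff_id.sub contDiff_const)).contDiffOn
  exact hθ.bilinPullback (contDiffOn_adaptedChart_bilin A) (A.background.boost Λ c₀).domain.isOpen
    (fun x hx ↦ hx)

end Smoothness

/-! ## §4 Conjugation by the motion and the isometry clause: the model mismatch vanishes -/

section Conj

variable (Λ : lorentzGroup) (c₀ : E4)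

/-- **Derivative of the conjugate** `Φ = P ∘ Θ ∘ P⁻¹`: `DΦ(x) = Λ ∘ DΘ(P⁻¹ x) ∘ Λ⁻¹` wherever `Θ` is
differentiable at `P⁻¹ x`. [folklore] -/
theorem fderiv_conj {Θ : E4 → E4} {x : E4} (hΘ : DifferentiableAt ℝ Θ (poincareInv Λ c₀ x)) :
    fderiv ℝ (fun x ↦ (Λ : E4 ≃L[ℝ] E4) (Θ (poincareInv Λ c₀ x)) + c₀) x =
      ((Λ : E4 ≃L[ℝ] E4) : E4 →L[ℝ] E4).comp
        ((fderiv ℝ Θ (poincareInv Λ c₀ x)).comp ((Λ : E4 ≃L[ℝ] E4).symm : E4 →L[ℝ] E4)) := by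
  have h1 : HasFDerivAt (fun x ↦ Θ (poincareInv Λ c₀ x))
      ((fderiv ℝ Θ (poincareInv Λ c₀ x)).comp ((Λ : E4 ≃L[ℝ] E4).symm : E4 →L[ℝ] E4)) x :=
    hΘ.hasFDerivAt.comp x (hasFDerivAt_poincareInv Λ c₀ x)
  have h2 := (((Λ : E4 ≃L[ℝ] E4) : E4 →L[ℝ] E4).hasFDerivAt.comp x h1).add_const c₀
  exact h2.fderiv

variable {𝓑 : StationaryAFBlackHole.{0}} (A : 𝓑.AdaptedChart)

/-- **Under the isometry clause the model mismatch vanishes.** If `Θ` is differentiable on the Kerr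
exterior and `A.bilin (Θ z) (DΘ v) (DΘ w) = Kerr.bilin M a z v w` there, then for `Φ = P ∘ Θ ∘ P⁻¹`
and `x` in the boosted exterior, `bilinPullback Φ (A.background.boost Λ c₀).bilin x = boostedKerrBilin Λ c₀ M a x`.
[folklore] -/
theorem bilinPullback_conj_boost_eq_boostedKerrBilin {M a : ℝ} {Θ : E4 → E4}
    (hΘd : ∀ z ∈ (Kerr.exterior M a : Set E4), DifferentiableAt ℝ Θ z)
    (hiso : ∀ z ∈ (Kerr.exterior M a : Set E4), ∀ v w : E4,
      A.bilin (Θ z) (fderiv ℝ Θ z v) (fderiv ℝ Θ z w) = Kerr.bilin M a z v w)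
    {x : E4} (hx : poincareInv Λ c₀ x ∈ (Kerr.exterior M a : Set E4)) :
    bilinPullback (fun x ↦ (Λ : E4 ≃L[ℝ] E4) (Θ (poincareInv Λ c₀ x)) + c₀) (A.background.boost Λ c₀).bilin x =
      boostedKerrBilin Λ c₀ M a x := by
  ext v w
  rw [bilinPullback_apply, fderiv_conj Λ c₀ (hΘd _ hx), ModelBackground.boost_bilin_apply,
    boostedKerrBilin_apply]
  have hP : poincareInv Λ c₀ ((Λ : E4 ≃L[ℝ] E4) (Θ (poincareInv Λ c₀ x)) + c₀) =
      Θ (poincareInv Λ c₀ x) := by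
    rw [poincareInv, add_sub_cancel_right, ContinuousLinearEquiv.symm_apply_apply]
  have hv : ∀ u : E4, (Λ : E4 ≃L[ℝ] E4).symm ((((Λ : E4 ≃L[ℝ] E4) : E4 →L[ℝ] E4).comp
      ((fderiv ℝ Θ (poincareInv Λ c₀ x)).comp ((Λ : E4 ≃L[ℝ] E4).symm : E4 →L[ℝ] E4))) u) =
        fderiv ℝ Θ (poincareInv Λ c₀ x) ((Λ : E4 ≃L[ℝ] E4).symm u) := fun u ↦ by
    rw [ContinuousLinearMap.comp_apply, ContinuousLinearMap.comp_apply, ContinuousLinearEquiv.coe_coe,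
      ContinuousLinearEquiv.coe_coe, ContinuousLinearEquiv.symm_apply_apply]
  rw [hP, hv, hv]
  exact hiso _ hx _ _

/-- **Registered helper `deviation_readapt_eq`.** On the boosted Kerr exterior, the metric deviation of
the RE-ADAPTED chart `ψ ∘ Φ̂` (`Φ = P ∘ Θ ∘ P⁻¹`, `Θ` smooth on a Kerr–Schild region containing the
exterior and mapping it into `A.domain`, isometric on the exterior from `Kerr.bilin M a` to `A.bilin`)
from `boostedKerrBackground Λ c₀ M a` EQUALS the coordinate pullback along `Φ` of the deviation of `ψ`
from the moved adapted background (extended by zero). [folklore] -/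
theorem deviation_readapt_eq : ∀ (𝓢 : Spacetime.{0} 4) (𝓑 : StationaryAFBlackHole.{0}) (A : 𝓑.AdaptedChart) (Λ : lorentzGroup) (c₀ : E4) (M a r₀ : ℝ) (Θ : E4 → E4) (ψ : (A.background.boost Λ c₀).domain → 𝓢.carrier) (hψ : MDifferentiable 𝓘(ℝ, E4) (𝓡 4) ψ) (hr₀ : r₀ ≤ Kerr.rPlus M a) (hΘs : ContDiffOn ℝ ∞ Θ (Kerr.region a r₀ : Set E4)) (hΘm : Set.MapsTo Θ (Kerr.region a r₀ : Set E4) (A.domain : Set E4)) (hiso : ∀ z ∈ (Kerr.exterior M a : Set E4), ∀ v w : E4, A.bilin (Θ z) (fderiv ℝ Θ z v) (fderiv ℝ Θ z w) = Kerr.bilin M a z v w) (hmaps : Set.MapsTo (fun x ↦ (Λ : E4 ≃L[ℝ] E4) (Θ (poincareInv Λ c₀ x)) + c₀) ((boostedKerrBackground Λ c₀ M a).domain : Set E4) ((A.background.boost Λ c₀).domain : Set E4)) (x : (boostedKerrBackground Λ c₀ M a).domain), 𝓢.deviation (boostedKerrBackground Λ c₀ M a) (fun y ↦ ψ ⟨(Λ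 : E4 ≃L[ℝ] E4) (Θ (poincareInv Λ c₀ y.1)) + c₀, hmaps y.2⟩) x = bilinPullback (fun x ↦ (Λ : E4 ≃L[ℝ] E4) (Θ (poincareInv Λ c₀ x)) + c₀) (𝓢.deviationExtend (A.background.boost Λ c₀) ψ) x.1 := by
  intro 𝓢 𝓑 A Λ c₀ M a r₀ Θ ψ hψ hr₀ hΘs hΘm hiso hmaps x
  have hsub : (Kerr.exterior M a : Set E4) ⊆ (Kerr.region a r₀ : Set E4) := fun z hz ↦
    Kerr.mem_region.2 ((max_le_max hr₀ le_rfl).trans_lt (Kerr.mem_exterior.1 hz))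
  have hst : MapsTo (poincareInv Λ c₀) ((boostedKerrBackground Λ c₀ M a).domain : Set E4)
      (Kerr.region a r₀ : Set E4) := fun x hx ↦ hsub (mem_boostedKerrExterior.1 hx)
  have hPi : ContDiffOn ℝ ∞ (poincareInv Λ c₀) ((boostedKerrBackground Λ c₀ M a).domain : Set E4) :=
    ((Λ : E4 ≃L[ℝ] E4).symm.contDiff.comp (contDiff_id.sub contDiff_const)).contDiffOn
  have hΦ : ContDiffOn ℝ ∞ (fun x ↦ (Λ : E4 ≃L[ℝ] E4) (Θ (poincareInv Λ c₀ x)) + c₀)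
      ((boostedKerrBackground Λ c₀ M a).domain : Set E4) :=
    ((Λ : E4 ≃L[ℝ] E4).contDiff.comp_contDiffOn (hΘs.comp hPi hst)).add contDiffOn_const
  rw [deviation_readapt 𝓢 _ _ hψ hΦ hmaps x]
  have hΘd : ∀ z ∈ (Kerr.exterior M a : Set E4), DifferentiableAt ℝ Θ z := fun z hz ↦
    (hΘs.differentiableOn (by simp)).differentiableAt ((Kerr.region a r₀).isOpen.mem_nhds (hsub hz))
  have hx : poincareInv Λ c₀ x.1 ∈ (Kerr.exterior M a : Set E4) := mem_boostedKerrExterior.1 x.2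
  rw [bilinPullback_conj_boost_eq_boostedKerrBilin Λ c₀ A hΘd hiso (x := x.1) hx]
  ext v w
  simp only [add_apply, sub_apply, boostedKerrBackground, sub_self, add_zero]

/-- **Truncated slab norms of the re-adapted chart.** Under the hypotheses of `deviation_readapt_eq`,
the `Cᵏ` truncated slab deviations of `ψ ∘ Φ̂` from boosted Kerr are the `Cᵏ` sup norms over the same
slabs of `bilinPullback Φ (deviationExtend (A.background.boost Λ c₀) ψ)` (the two functions have the
same germ at every point of the open boosted exterior, `supCkENorm_congr`). [folklore] -/
theorem truncDeviationCk_readapt_eq (𝓢 : Spacetime.{0} 4) {𝓑 : StationaryAFBlackHole.{0}}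
    (A : 𝓑.AdaptedChart) (Λ : lorentzGroup) (c₀ : E4) {M a r₀ : ℝ} {Θ : E4 → E4}
    {ψ : (A.background.boost Λ c₀).domain → 𝓢.carrier} (hψ : MDifferentiable 𝓘(ℝ, E4) (𝓡 4) ψ)
    (hr₀ : r₀ ≤ Kerr.rPlus M a) (hΘs : ContDiffOn ℝ ∞ Θ (Kerr.region a r₀ : Set E4))
    (hΘm : MapsTo Θ (Kerr.region a r₀ : Set E4) (A.domain : Set E4))
    (hiso : ∀ z ∈ (Kerr.exterior M a : Set E4), ∀ v w : E4,
      A.bilin (Θ z) (fderiv ℝ Θ z v) (fderiv ℝ Θ z w) = Kerr.bilin M a z v w)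
    (hmaps : MapsTo (fun x ↦ (Λ : E4 ≃L[ℝ] E4) (Θ (poincareInv Λ c₀ x)) + c₀)
      ((boostedKerrBackground Λ c₀ M a).domain : Set E4) ((A.background.boost Λ c₀).domain : Set E4))
    (k : ℕ) (R τ : ℝ) :
    𝓢.truncDeviationCk (boostedKerrBackground Λ c₀ M a)
        (fun y ↦ ψ ⟨(Λ : E4 ≃L[ℝ] E4) (Θ (poincareInv Λ c₀ y.1)) + c₀, hmaps y.2⟩) k R τ =
      supCkENorm (Subtype.val '' (boostedKerrBackground Λ c₀ M a).truncTimeSlab R τ) k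
        (bilinPullback (fun x ↦ (Λ : E4 ≃L[ℝ] E4) (Θ (poincareInv Λ c₀ x)) + c₀)
          (𝓢.deviationExtend (A.background.boost Λ c₀) ψ)) := by
  refine supCkENorm_congr fun u hu ↦ ?_
  obtain ⟨y, -, rfl⟩ := hu
  filter_upwards [(boostedKerrBackground Λ c₀ M a).domain.isOpen.mem_nhds y.2] with z hz
  rw [deviationExtend_apply_of_mem 𝓢 _ _ hz]
  exact deviation_readapt_eq 𝓢 𝓑 A Λ c₀ M a r₀ Θ ψ hψ hr₀ hΘs hΘm hiso hmaps ⟨z, hz⟩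

end Conj

end Summit.FinalStateConjecture.FinalStateConjecture.Theorems.SymplecticDualOfTheBomb

end
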